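/-
Copyright (c) 2026 the pub-hodgecm-mathlib formalisation cell (harness21).  Prover seat hodgecm-mathlib-LH7-p02 (g6): LH4-plan (g7) LAYER C, claim (R0) memo
`F0/P3c/LH7/LH7-p02/g6/c3e0/CLAIM-R0-near-ell0.v1.LH7p02g6.md` §3 — the `X`-currency (2-free) pair count of the whole `j = 0` NEAR column (`ℓ ≥ 0`); 2026-09-02.
-/
import Literature.NumberTheory.LocalFields.UnramifiedQuadraticNormResidueShiftPairs       -- ★ FILE 8 (brings FILE 7 `natCard_norm_congr_shift`, FILES 1–6, `natCard_subtype_comp_eq_mul`)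
import HarnessLib

/-!
# The pair count of Flicker's Prop. 13 near row in the `X`-CURRENCY of the trace normal form: `#{(u, x) : σ̄x = −x, N(κ(uσ̄u)⁻¹ + x + ξ₀) ≡ r(s + r) (mod 𝔪^j)}`
# `= q^{m−1}(q+1) · (q^{(m−ℓ)−(j−2ℓ)} · q^{m−ℓ−1}(q+1))` — every `ℓ ≥ 0`, every residue characteristic (FILE 8‴ of the story `UnramifiedQuadraticNorm*`)
(Flicker (1998), *Elementary proof of the fundamental lemma for a unitary group*, Prop. 13 p. 93; Serre, *Local Fields*, V §2)

Topic `NumberTheory/LocalFields`, namespace `Literature.NumberTheory.LocalFields.UnramifiedQuadraticNorm`.  THEOREMS ONLY: no definition, no named fact, no instance, no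
notation, no `sorry`; kernel lane `--supports stmt-HodgeConjecture-24833`.  Cell `pub/hodgecm-mathlib` (D-0151), crux H413; LH4-plan (g7) LAYER C (trace frame), claim (R0) of
2026-09-02 16:33Z settled on paper (memo `CLAIM-R0-near-ell0.v1` ce7670c6d5446838) and here in Lean.  HC_CM is proved only modulo the 7 printed citations (2 remaining named inputs:
hLiu418 = stmt-HodgeConjecture-24832, h413 = stmt-HodgeConjecture-24833) until rung 0 closes; count-neutral ((D-UNR) stays PRINT by D74′); proves no letter.

THE MATHEMATICS.  The (C3b) normal form (★ p851968) of the `j = 0` near criterion is `|N(X) − C| ≤ …` with `X = κν⁻¹ + w + r`, `ν = uσu`, `w` on the trace fibre `w + σw = s`, `r`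
σ-fixed, `C = r(s + r)`, `κ + σκ` a UNIT and **`s` a UNIT** (`s = −yσy`, `|y| = 1`).  Writing `w = x + (ξ₀ − r)` with `x` the ANTI-FIXED (trace-zero) skew parameter of
`p(u, x, w) ∈ P_H` and `ξ₀` any element with `ξ₀ + σξ₀ = 2r + s`, the variable is `X = κ(uσ̄u)⁻¹ + x + ξ₀` and this file counts the pairs `(u, x)` DIRECTLY in that currency — no frame
splitting, no `½`, no tie between a shift and the target beyond the normal form's own `C = r(s+r)`:
(i) FIBRES BY TRACE: `κF + x = κF′ + x′` with `F, F′` fixed and `x, x′` anti-fixed forces `(κ + σ̄κ)(F − F′) = 0`, so `F = F′`, `x = x′` (`mul_fixed_add_anti_inj`); hence the fibres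
of `(u, x) ↦ X` are norm fibres (★ `natCard_norm_fibre_quotient_pow`); (ii) RANGE: every class `z` is `ξ₀ + κF + x` with `F = (z − ξ₀ + σ̄(z − ξ₀))·(κ + σ̄κ)⁻¹` fixed and `x` anti-fixed
(`exists_eq_mul_fixed_add_anti_ring`), and **`F` is a UNIT whenever `N z ≡ r(s+r) (mod 𝔪)`** (`isUnit_fixed_of_norm_sub_traceX`): else `Tr z ≡ 2r + s`, so
`(z − r)σ̄(z − r) = (N z − C) − r·(κ + σ̄κ)F ∈ 𝔪`, so `z ≡ r`, so `Tr z ≡ 2r`, so `s ∈ 𝔪` — absurd; equivalently the residual polynomial `Y² − (2r̄ + s̄)Y + r̄(r̄ + s̄) =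
(Y − r̄)(Y − r̄ − s̄)` splits over `k_F` with DISTINCT roots (this is (R0): the «bad residue count» `r` of FINDING #19 vanishes identically); (iii) the `z`-count is ★ FILE 7
`natCard_norm_congr_shift` (target `r(s+r) = ϖ^{2ℓ}γ`, ANY `ℓ ≥ 0` with `2ℓ < j ≤ m`).  ★'s tame FILE 8 is the instance `κ = 1`, `s = 2`, `ξ₀ = e + 1 = r + … ` (roots `e ± 1`).

* §1 (local ring `A`, involution `τ`, `κ` with `κ + τκ ∈ Aˣ`): `mul_fixed_add_anti_inj`, `exists_eq_mul_fixed_add_anti_ring`, **`isUnit_fixed_of_norm_sub_traceX`**.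
* §2 **`natCard_pairs_norm_congr_traceX`** (`2ℓ < j ≤ m`, any `ℓ`): RHS = ★ FILE 8's VERBATIM.

## References
* [Flicker1998UnitaryFL] Y. Z. Flicker, *Elementary proof of the fundamental lemma for a unitary group*, Canad. J. Math. 50 (1998), 74–98: Prop. 13 p. 93.
* [Serre1979] J.-P. Serre, *Local Fields*, GTM 67 (1979), Ch. V §2 Prop. 2–3.
-/

set_option autoImplicit false

namespace Literature.NumberTheory.LocalFields.UnramifiedQuadraticNorm

open Literature.LinearAlgebra.Matrix.HermitianFormsHensel Literature.NumberTheory.GaloisRepresentations IsLocalRing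

universe u

variable {R : Type u} [CommRing R] (σ : R →+* R)

/-! ## §1 The `κ`-weighted fixed ⊕ anti-fixed splitting and the unit claim of the near column -/

section Local

variable {A : Type u} [CommRing A] (τ : A →+* A) (hτ : ∀ a, τ (τ a) = a) {κ : A} (hκ : IsUnit (κ + τ κ))

include hκ in
/-- **Uniqueness of `κF + x`** (`F` fixed, `x` anti-fixed, `κ + τκ` a unit): apply `τ` and add — `(κ + τκ)(F − F′) = 0`. No `2`. [cite: Flicker1998UnitaryFL, Prop. 13 p. 92] -/
theorem mul_fixed_add_anti_inj {F F' x x' : A} (hF : τ F = F) (hF' : τ F' = F') (hx : τ x = -x) (hx' : τ x' = -x')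
    (h : κ * F + x = κ * F' + x') : F = F' ∧ x = x' := by
  have hτ' : τ κ * F - x = τ κ * F' - x' := by
    have := congrArg τ h
    rw [map_add, map_add, map_mul, map_mul, hF, hF', hx, hx'] at this
    simpa [sub_eq_add_neg] using this
  have h0 : (κ + τ κ) * (F - F') = 0 := by linear_combination h + hτ'
  have hFF : F = F' := sub_eq_zero.1 ((hκ.mul_right_eq_zero).1 h0)
  refine ⟨hFF, ?_⟩
  rw [hFF] at h
  exact add_left_cancel h

include hτ hκ in
/-- **Existence of the `κ`-weighted splitting**: every `c ∈ A` is `κF + x` with `τF = F`, `τx = −x` — `F := (c + τc)(κ + τκ)⁻¹`, `x := c − κF`.  Ring-level twin of ★ (C3b)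
`exists_eq_mul_fixed_add_anti`. [cite: Flicker1998UnitaryFL, Prop. 13 p. 92] -/
theorem exists_eq_mul_fixed_add_anti_ring (c : A) : ∃ F x : A, τ F = F ∧ τ x = -x ∧ c = κ * F + x := by
  obtain ⟨d, hd⟩ := hκ
  have hτd : τ (d : A) = d := by rw [hd, map_add, hτ, add_comm]
  have hτdi : τ (↑d⁻¹ : A) = ↑d⁻¹ := by
    have h1 : τ (↑d⁻¹ : A) * (d : A) = 1 := by rw [← hτd, ← map_mul, Units.inv_mul, map_one]
    calc τ (↑d⁻¹ : A) = τ ↑d⁻¹ * ((d : A) * ↑d⁻¹) := by rw [Units.mul_inv, mul_one]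
      _ = ↑d⁻¹ := by rw [← mul_assoc, h1, one_mul]
  set F : A := (c + τ c) * ↑d⁻¹ with hFdef
  have hτF : τ F = F := by rw [hFdef, map_mul, map_add, hτ, hτdi, add_comm]
  refine ⟨F, c - κ * F, hτF, ?_, by ring⟩
  rw [map_sub, map_mul, hτF]
  -- `τc − τκ·F = −(c − κF)` ⟺ `c + τc = (κ + τκ)F`
  have hsum : (κ + τ κ) * F = c + τ c := by rw [hFdef, ← hd, mul_comm, mul_assoc, Units.inv_mul, mul_one]
  linear_combination -hsum

include hτ in
/-- **THE UNIT CLAIM OF THE NEAR COLUMN, every `ℓ`, every characteristic (claim (R0))**: in a local ring `A` with involution `τ` (ANY `κ`), let `r` be `τ`-fixed, `s` a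
UNIT, `ξ₀ + τξ₀ = r + r + s`, and `z = ξ₀ + κF + x` (`τF = F`, `τx = −x`) with `N z − r(s + r)` a NON-UNIT.  Then `F` is a unit.  (Else `Tr z − (2r + s) = (κ + τκ)F ∈ 𝔪`
and `(z − r)·τ(z − r) = (N z − r(s+r)) − r(κ + τκ)F ∈ 𝔪`, so `z − r ∈ 𝔪`, so `s = (z − r) + τ(z − r) − (κ + τκ)F ∈ 𝔪` — absurd.  Residually: `Y² − (2r̄+s̄)Y + r̄(r̄+s̄) = (Y − r̄)(Y − r̄ − s̄)`
has distinct roots in `k_F`.) [cite: Flicker1998UnitaryFL, Prop. 13 p. 93] -/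
theorem isUnit_fixed_of_norm_sub_traceX [IsLocalRing A] {r s ξ₀ F x : A} (hτr : τ r = r) (hs : IsUnit s)
    (hξ : ξ₀ + τ ξ₀ = r + r + s) (hF : τ F = F) (hx : τ x = -x)
    (hN : ¬ IsUnit ((ξ₀ + κ * F + x) * τ (ξ₀ + κ * F + x) - r * (s + r))) : IsUnit F := by
  by_contra hFu
  have hFm : F ∈ maximalIdeal A := (mem_maximalIdeal _).2 hFu
  have hNm : (ξ₀ + κ * F + x) * τ (ξ₀ + κ * F + x) - r * (s + r) ∈ maximalIdeal A := (mem_maximalIdeal _).2 hN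
  set z : A := ξ₀ + κ * F + x with hz
  have htrz : z + τ z = r + r + s + (κ + τ κ) * F := by
    rw [hz, map_add, map_add, map_mul, hF, hx]; linear_combination hξ
  -- `(z − r)·τ(z − r) ∈ 𝔪`
  have hkey : (z - r) * τ (z - r) = (z * τ z - r * (s + r)) - r * ((κ + τ κ) * F) := by
    rw [map_sub, hτr]; linear_combination (-r) * htrz
  have hprod : (z - r) * τ (z - r) ∈ maximalIdeal A := by
    rw [hkey]
    exact Ideal.sub_mem _ hNm (Ideal.mul_mem_left _ _ (Ideal.mul_mem_left _ _ hFm))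
  -- hence `z − r ∈ 𝔪`
  have hzr : z - r ∈ maximalIdeal A := by
    rcases Ideal.IsPrime.mem_or_mem (IsLocalRing.maximalIdeal.isMaximal A).isPrime hprod with h | h
    · exact h
    · exact (mem_maximalIdeal _).2 fun hu => ((mem_maximalIdeal _).1 h) (hu.map τ)
  have hτzr : τ (z - r) ∈ maximalIdeal A := by
    refine (mem_maximalIdeal _).2 fun hu => ((mem_maximalIdeal _).1 hzr) ?_
    have h := hu.map τ; rwa [hτ] at h
  -- `s = (z − r) + τ(z − r) − (κ + τκ)F ∈ 𝔪`
  have hsm : s ∈ maximalIdeal A := by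
    have h : s = (z - r) + τ (z - r) - (κ + τ κ) * F := by
      rw [map_sub, hτr]; linear_combination -htrz
    rw [h]
    exact Ideal.sub_mem _ (Ideal.add_mem _ hzr hτzr) (Ideal.mul_mem_left _ _ hFm)
  exact (mem_maximalIdeal _).1 hsm hs

end Local

/-! ## §2 The pair count of the near column in the `X`-currency (no `2 ∈ Rˣ`, any `ℓ ≥ 0`) -/

section Count

variable [IsDomain R] [IsDiscreteValuationRing R] [Finite (ResidueField R)] [IsAdicComplete (maximalIdeal R) R]
  (hσ : ∀ a, σ (σ a) = a) {a : R} (ha : IsUnit (σ a - a)) {q : ℕ} (hq : Nat.card (ResidueField R) = q ^ 2)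

include ha hq in
/-- **THE PAIR COUNT OF THE `j = 0` NEAR ROW IN THE `X`-CURRENCY — every `ℓ ≥ 0`, every residue characteristic** (claim (R0)): for `κ` with `κ + σκ ∈ Rˣ`, `r` σ-fixed, `s` a UNIT (no `σs = s` needed),
`ξ₀` with `ξ₀ + σξ₀ = r + r + s`, and a target `r(s + r) = ϖ^{2ℓ}γ` (`γ ∈ (R^σ)^×`, `2ℓ < j ≤ m`, `1 ≤ m`):
`#{(u, x) ∈ (R ⧸ 𝔪^m)² : u ∈ (R⧸𝔪^m)^×, σ̄x = −x, N(κ̄(uσ̄u)⁻¹ + x + ξ̄₀) ≡ ϖ^{2ℓ}γ (mod 𝔪^j)} = q^{m−1}(q+1) · (q^{(m−ℓ)−(j−2ℓ)} · q^{m−ℓ−1}(q+1))` — ★ FILE 8's value VERBATIM: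
fibres by trace (§1), range by the unit claim (§1), `z`-count ★ `natCard_norm_congr_shift`. [cite: Flicker1998UnitaryFL, Prop. 13 p. 93] [cite: Serre1979, Ch. V §2 Prop. 3] -/
theorem natCard_pairs_norm_congr_traceX {p : R} (hp : Irreducible p) (hσp : σ p = p) {m j ℓ : ℕ} (hm : 1 ≤ m) (hj : 2 * ℓ < j) (hjm : j ≤ m)
    {κ r s ξ₀ γ : R} (hκ : IsUnit (κ + σ κ)) (hσr : σ r = r) (hs : IsUnit s) (hξ : ξ₀ + σ ξ₀ = r + r + s)
    (hγ : IsUnit γ) (hσγ : σ γ = γ) (hC : r * (s + r) = p ^ (2 * ℓ) * γ) :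
    Nat.card {ux : (R ⧸ maximalIdeal R ^ m) × (R ⧸ maximalIdeal R ^ m) // IsUnit ux.1 ∧
      Ideal.quotientMap (maximalIdeal R ^ m) σ (maximalIdeal_pow_le_comap σ hσ m) ux.2 = -ux.2 ∧
      Ideal.Quotient.factor (Ideal.pow_le_pow_right hjm)
        ((Ideal.Quotient.mk (maximalIdeal R ^ m) κ *
              Ring.inverse (ux.1 * Ideal.quotientMap (maximalIdeal R ^ m) σ (maximalIdeal_pow_le_comap σ hσ m) ux.1) +
            ux.2 + Ideal.Quotient.mk (maximalIdeal R ^ m) ξ₀) *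
          Ideal.quotientMap (maximalIdeal R ^ m) σ (maximalIdeal_pow_le_comap σ hσ m)
            (Ideal.Quotient.mk (maximalIdeal R ^ m) κ *
                Ring.inverse (ux.1 * Ideal.quotientMap (maximalIdeal R ^ m) σ (maximalIdeal_pow_le_comap σ hσ m) ux.1) +
              ux.2 + Ideal.Quotient.mk (maximalIdeal R ^ m) ξ₀)) =
        Ideal.Quotient.mk (maximalIdeal R ^ j) (p ^ (2 * ℓ) * γ)} =
      (q ^ (m - 1) * (q + 1)) * (q ^ ((m - ℓ) - (j - 2 * ℓ)) * (q ^ ((m - ℓ) - 1) * (q + 1))) := by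
  classical
  haveI := CompleteLocalRing.finite_quotient_maximalIdeal_pow (R := R) m
  set A := R ⧸ maximalIdeal R ^ m with hA
  set τ := Ideal.quotientMap (maximalIdeal R ^ m) σ (maximalIdeal_pow_le_comap σ hσ m) with hτ
  set φ := Ideal.Quotient.factor (S := maximalIdeal R ^ m) (T := maximalIdeal R ^ j) (Ideal.pow_le_pow_right hjm) with hφ
  have hττ : ∀ z, τ (τ z) = z := quotientMap_quotientMap σ hσ m
  have hτmk : ∀ w : R, τ (Ideal.Quotient.mk _ w) = Ideal.Quotient.mk _ (σ w) := fun w => Ideal.quotientMap_mk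
  haveI : Nontrivial A := nontrivial_quotient_pow (R := R) hm
  haveI : IsLocalRing A := IsLocalRing.of_surjective' (Ideal.Quotient.mk (maximalIdeal R ^ m)) Ideal.Quotient.mk_surjective
  -- the data in `A`
  set κA : A := Ideal.Quotient.mk _ κ with hκA
  set rA : A := Ideal.Quotient.mk _ r with hrA
  set sA : A := Ideal.Quotient.mk _ s with hsA
  set ξA : A := Ideal.Quotient.mk _ ξ₀ with hξA
  have hκAu : IsUnit (κA + τ κA) := by
    have h := hκ.map (Ideal.Quotient.mk (maximalIdeal R ^ m)); rwa [map_add, ← hτmk] at h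
  have hτrA : τ rA = rA := by rw [hrA, hτmk, hσr]
  have hsAu : IsUnit sA := hs.map _
  have hξA' : ξA + τ ξA = rA + rA + sA := by rw [hξA, hτmk, hrA, hsA, ← map_add, hξ, map_add, map_add]
  set cA : A := Ideal.Quotient.mk _ (p ^ (2 * ℓ) * γ) with hcA
  have hcC : cA = rA * (sA + rA) := by rw [hcA, ← hC, hrA, hsA, map_mul, map_add]
  have hτinv : ∀ w : Aˣ, τ (w : A) = w → τ (↑w⁻¹ : A) = ↑w⁻¹ := fun w hw => by
    have h1 : τ (↑w⁻¹ : A) * (w : A) = 1 := by rw [← hw, ← map_mul, Units.inv_mul, map_one]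
    calc τ (↑w⁻¹ : A) = τ ↑w⁻¹ * ((w : A) * ↑w⁻¹) := by rw [Units.mul_inv, mul_one]
      _ = ↑w⁻¹ := by rw [← mul_assoc, h1, one_mul]
  have hq0 : 0 < q := by
    rcases Nat.eq_zero_or_pos q with h0 | h0
    · exfalso
      have h1 : 0 < Nat.card (ResidueField R) := Nat.card_pos
      rw [hq, h0] at h1; simp at h1
    · exact h0
  let Nm : A → A := fun u => u * τ u
  have hNfix : ∀ u, τ (Nm u) = Nm u := fun u => by simp only [Nm, map_mul, hττ, mul_comm]
  let α := {ux : A × A // IsUnit ux.1 ∧ τ ux.2 = -ux.2}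
  let Z : α → A := fun w => κA * Ring.inverse (Nm w.1.1) + w.1.2 + ξA
  let G : A → Prop := fun z => φ (z * τ z) = Ideal.Quotient.mk (maximalIdeal R ^ j) (p ^ (2 * ℓ) * γ)
  haveI : Finite α := Subtype.finite
  have e0 : {ux : A × A // IsUnit ux.1 ∧ τ ux.2 = -ux.2 ∧ G (κA * Ring.inverse (Nm ux.1) + ux.2 + ξA)} ≃ {w : α // G (Z w)} :=
    { toFun := fun w => ⟨⟨w.1, w.2.1, w.2.2.1⟩, w.2.2.2⟩
      invFun := fun w => ⟨w.1.1, w.1.2.1, w.1.2.2, w.2⟩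
      left_inv := fun w => rfl
      right_inv := fun w => rfl }
  rw [Nat.card_congr e0]
  -- `Ring.inverse (Nm u)` is `τ`-fixed
  have hfixN : ∀ w : α, τ (Ring.inverse (Nm w.1.1)) = Ring.inverse (Nm w.1.1) := fun w => by
    have hu : IsUnit (Nm w.1.1) := w.2.1.mul (w.2.1.map τ)
    rw [← hu.unit_spec, Ring.inverse_unit]
    exact hτinv hu.unit (by rw [hu.unit_spec]; exact hNfix _)
  -- Step 1: fibres of `Z` are norm fibres
  have hfibre : ∀ z ∈ Set.range Z, Nat.card {w : α // Z w = z} = q ^ (m - 1) * (q + 1) := by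
    rintro _ ⟨w₀, rfl⟩
    obtain ⟨⟨u₀, x₀⟩, hu₀, hx₀⟩ := w₀
    have hN₀ : IsUnit (Nm u₀) := hu₀.mul (hu₀.map τ)
    obtain ⟨v, hv⟩ := Ideal.Quotient.mk_surjective u₀
    have hvu : IsUnit v := isUnit_of_isUnit_mk_pow (R := R) hm (by rw [hv]; exact hu₀)
    have hr : Ideal.Quotient.mk (maximalIdeal R ^ m) (v * σ v) = Nm u₀ := by
      show _ = u₀ * τ u₀; rw [← hv, hτmk, map_mul]
    have hrunit : IsUnit (v * σ v) := hvu.mul (hvu.map σ)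
    have hσrr : σ (v * σ v) = v * σ v := by rw [map_mul, hσ, mul_comm]
    rw [← natCard_norm_fibre_quotient_pow σ hσ ha hq hm hrunit hσrr]
    refine Nat.card_congr
      { toFun := fun w => ⟨w.1.1.1, ?_⟩
        invFun := fun u => ⟨⟨(u.1, x₀), ?_, hx₀⟩, ?_⟩
        left_inv := fun w => ?_
        right_inv := fun u => rfl }
    · have h := w.2
      change κA * Ring.inverse (Nm w.1.1.1) + w.1.1.2 + ξA = κA * Ring.inverse (Nm u₀) + x₀ + ξA at h
      obtain ⟨hF, -⟩ := mul_fixed_add_anti_inj τ hκAu (hfixN w.1) (hfixN ⟨(u₀, x₀), hu₀, hx₀⟩) w.1.2.2 hx₀ (add_right_cancel h)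
      have hNw : IsUnit (Nm w.1.1.1) := w.1.2.1.mul (w.1.2.1.map τ)
      have key : Nm w.1.1.1 = Nm u₀ := by
        rw [← Ring.inverse_inverse hNw, hF, Ring.inverse_inverse hN₀]
      show w.1.1.1 * τ w.1.1.1 = Ideal.Quotient.mk _ (v * σ v)
      rw [hr]; exact key
    · have h : u.1 * τ u.1 = Nm u₀ := u.2.trans hr
      exact isUnit_of_mul_isUnit_left (h ▸ hN₀)
    · show κA * Ring.inverse (u.1 * τ u.1) + x₀ + ξA = κA * Ring.inverse (Nm u₀) + x₀ + ξA
      have h : u.1 * τ u.1 = Nm u₀ := u.2.trans hr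
      rw [h]
    · apply Subtype.ext; apply Subtype.ext
      have h := w.2
      change κA * Ring.inverse (Nm w.1.1.1) + w.1.1.2 + ξA = κA * Ring.inverse (Nm u₀) + x₀ + ξA at h
      obtain ⟨-, hX⟩ := mul_fixed_add_anti_inj τ hκAu (hfixN w.1) (hfixN ⟨(u₀, x₀), hu₀, hx₀⟩) w.1.2.2 hx₀ (add_right_cancel h)
      exact Prod.ext rfl hX.symm
  rw [Literature.NumberTheory.Automorphic.UnitaryGroup.natCard_subtype_comp_eq_mul Z G _ hfibre]
  congr 1
  -- Step 2: every `z` with `G z` is in the range of `Z`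
  have hrange : ∀ z, G z → z ∈ Set.range Z := by
    intro z hz
    obtain ⟨F, X, hFfix, hXanti, hzFX⟩ := exists_eq_mul_fixed_add_anti_ring τ hττ hκAu (z - ξA)
    have hz' : z = ξA + κA * F + X := by linear_combination hzFX
    have hGz : ¬ IsUnit ((ξA + κA * F + X) * τ (ξA + κA * F + X) - rA * (sA + rA)) := by
      rw [← hz', ← hcC]
      intro hu
      have hj1 : 1 ≤ j := by omega
      haveI : Nontrivial (R ⧸ maximalIdeal R ^ j) := nontrivial_quotient_pow (R := R) hj1
      have hzero : φ (z * τ z - cA) = 0 := by rw [map_sub, hz, hcA, hφ, Ideal.Quotient.factor_mk, sub_self]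
      exact not_isUnit_zero (hzero ▸ hu.map φ)
    have hFu : IsUnit F := isUnit_fixed_of_norm_sub_traceX τ hττ hτrA hsAu hξA' hFfix hXanti hGz
    -- `n₁ := F⁻¹`, a fixed unit; pick `u` with `Nm u = n₁`
    set n₁ : A := ↑hFu.unit⁻¹ with hn₁
    have hn₁fix : τ n₁ = n₁ := by rw [hn₁]; exact hτinv hFu.unit (by rw [hFu.unit_spec]; exact hFfix)
    obtain ⟨r₀, hr₀⟩ := Ideal.Quotient.mk_surjective n₁
    have hmem : σ r₀ - r₀ ∈ maximalIdeal R ^ m := by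
      rw [← Ideal.Quotient.eq_zero_iff_mem, map_sub, sub_eq_zero, ← hτmk, hr₀, hn₁fix]
    obtain ⟨r₁, hrfix, hrr⟩ := exists_fixed_sub_mem σ hσ ha hmem
    have hrn : Ideal.Quotient.mk (maximalIdeal R ^ m) r₁ = n₁ := by
      rw [← hr₀, Ideal.Quotient.eq]; exact hrr
    have hru : IsUnit r₁ := isUnit_of_isUnit_mk_pow (R := R) hm (by rw [hrn, hn₁]; exact Units.isUnit _)
    have hpos : 0 < Nat.card {u : A // u * τ u = Ideal.Quotient.mk _ r₁} := by
      rw [natCard_norm_fibre_quotient_pow σ hσ ha hq hm hru hrfix]; exact Nat.mul_pos (pow_pos hq0 _) (Nat.succ_pos q)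
    obtain ⟨⟨u, hu⟩⟩ := Nat.card_pos_iff.1 hpos |>.1
    rw [hrn] at hu
    have huunit : IsUnit u := isUnit_of_mul_isUnit_left (by rw [show u * τ u = n₁ from hu, hn₁]; exact Units.isUnit _)
    refine ⟨⟨(u, X), huunit, hXanti⟩, ?_⟩
    show κA * Ring.inverse (u * τ u) + X + ξA = z
    rw [show u * τ u = n₁ from hu, hn₁, Ring.inverse_unit, inv_inv, hFu.unit_spec, hz']
    ring
  rw [Nat.card_congr (Equiv.subtypeEquivRight fun z => (and_iff_right_of_imp (hrange z) : z ∈ Set.range Z ∧ G z ↔ G z))]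
  -- Step 3: the `z`-count
  exact natCard_norm_congr_shift σ hσ ha hq hp hσp hj hjm hγ hσγ

end Count

end Literature.NumberTheory.LocalFields.UnramifiedQuadraticNorm
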